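import Literature.AlgebraicGeometry.GroupSchemes.BarsottiTateGroupHom
import Literature.AlgebraicGeometry.AbelianSchemes.PDivisibleGroupOfAbelianScheme
import HarnessLib

/-!
# `A ↦ A[p^∞]` is a functor: `f[N] : A[N] ⟶ A'[N]` and `f[p^∞] : A[p^∞] → A'[p^∞]` for a homomorphism of abelian schemes

Topic `Literature/AlgebraicGeometry/AbelianSchemes`; namespace `Literature.AlgebraicGeometry.AbelianSchemes.AbelianSchemeOver`.
Cell `hodgecm-mathlib` (D-0151), FLOOR 0, P6 «MOD programme» generic organ G3b (P6b desk census (iv) G3: «`f[p^∞]` of a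
homomorphism of abelian schemes through ★ F2's `torsionι`; needed by L4B1ff» = Serre–Tate full faithfulness); sibling of ★
`PDivisibleGroupOfAbelianScheme` (`torsion`, `torsionLift`, `pDivisibleGroup`) and ★ `GroupSchemes/BarsottiTateGroupHom`
(`BTGroup.Hom`, `existsUnique_hom_of_kernelPresentation`).  `--supports stmt-HodgeConjecture-24832`; COUNT-NEUTRAL: HC_CM is
proved only modulo the 7 printed citations until rung 0 closes; this file discharges none of them.  Two `def`s (`torsionMap`,
`pDivisibleGroupMap`) + theorems; no named fact, no instance, no notation, no `sorry`.

THE PRINT.  [Tate1967] §2 (2.1)–(2.2): `A ↦ A(p) = lim A[p^n]` is a functor from abelian schemes (indeed from group schemes with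
`[p]` an isogeny) to `p`-divisible groups; [MumfordFogartyKirwan1994] Ch. 6 §1 (homomorphisms commute with `n_X`).

WHAT IS HERE: §1 `mulN_comp_eq_comp_mulN : [N] ≫ f = f ≫ [N]`; **`torsionMap f N : A[N] ⟶ A'[N]`** (★ `torsionLift (ι ≫ f)`) with
`torsionMap_ι : f[N] ≫ ι = ι ≫ f`, **`torsionMap_id`, `torsionMap_comp`**, `torsionIncl_comp_torsionMap`, `torsionMulMap_comp_torsionMap`,
`torsionMap_left_comp` (the commuting square of schemes), `isMonHom_torsionMap` (commutative `A`, `A'`); §2 **`pDivisibleGroupMap f hp hg hg' :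
BTGroup.Hom (A.pDivisibleGroup hp hg) (A'.pDivisibleGroup hp hg')`** (layers `f[p^n]`), `pDivisibleGroupMap_app ∕ _app_comp_ι`,
**`pDivisibleGroupMap_id`, `pDivisibleGroupMap_comp`** (functoriality) and **`eq_pDivisibleGroupMap_of_app_comp_ι`** (UNIQUENESS: a
homomorphism `A[p^∞] → A'[p^∞]` restricting `f` on every layer is `f[p^∞]`).

NOT HERE: `f[p^∞]` an isogeny ∕ its kernel for `f` an isogeny; exactness; the `𝒪`-action on `A[p^∞]` (L4.2, which is
`pDivisibleGroupMap (ι a)` for `a ∈ 𝒪` plus the idempotent splitting).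

## References
* [Tate1967] J. T. Tate, *p-divisible groups*, Proc. Conf. Local Fields (Driebergen 1966), Springer 1967 — §2 (2.1)–(2.2).
* [MumfordFogartyKirwan1994] D. Mumford, J. Fogarty, F. Kirwan, *Geometric Invariant Theory*, 3rd ed. (1994) — Ch. 6 §1 (p. 115).
-/

noncomputable section

universe u

open CategoryTheory CategoryTheory.Limits AlgebraicGeometry MonoidalCategory CartesianMonoidalCategory
open scoped MonObj

namespace Literature.AlgebraicGeometry.AbelianSchemes

namespace AbelianSchemeOver

open Literature.AlgebraicGeometry.GroupSchemes

variable {S : Scheme.{u}} {A A' A'' : AbelianSchemeOver S}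

/-! ## §1 `f[N] : A[N] ⟶ A'[N]` -/

/-- A homomorphism commutes with multiplication by `N`: `[N]_A ≫ f = f ≫ [N]_{A'}`. [cite: MumfordFogartyKirwan1994, Ch. 6 §1 (p. 115)] -/
theorem mulN_comp_eq_comp_mulN (f : A.X ⟶ A'.X) [IsMonHom f] (N : ℕ) : A.mulN N ≫ f = f ≫ A'.mulN N := by
  rw [mulN_def, mulN_def, MonObj.pow_comp, Category.id_comp, MonObj.comp_pow, Category.comp_id]

/-- **`f[N] : A[N] ⟶ A'[N]`, the restriction of a homomorphism `f : A → A'` to the `N`-torsion** (`(ι ≫ f) ≫ [N] = ι ≫ [N] ≫ f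
= 1`, universal property of `A'[N]`). [cite: Tate1967, §2 (2.1)] -/
def torsionMap (f : A.X ⟶ A'.X) [IsMonHom f] (N : ℕ) : A.torsion N ⟶ A'.torsion N :=
  A'.torsionLift (A.torsionι N ≫ f) (by
    rw [Category.assoc, ← mulN_comp_eq_comp_mulN, ← Category.assoc, torsionι_comp_mulN, MonObj.one_comp])

/-- `f[N] ≫ ι = ι ≫ f`. [cite: Tate1967, §2 (2.1)] -/
@[reassoc (attr := simp)]
theorem torsionMap_ι (f : A.X ⟶ A'.X) [IsMonHom f] (N : ℕ) : torsionMap f N ≫ A'.torsionι N = A.torsionι N ≫ f :=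
  A'.torsionLift_ι _ _

/-- `(𝟙 A)[N] = 𝟙 A[N]`. [cite: Tate1967, §2 (2.1)] -/
@[simp]
theorem torsionMap_id (N : ℕ) : torsionMap (𝟙 A.X) N = 𝟙 (A.torsion N) :=
  A.torsion_hom_ext (by rw [torsionMap_ι, Category.comp_id, Category.id_comp])

/-- `(f ≫ g)[N] = f[N] ≫ g[N]`. [cite: Tate1967, §2 (2.1)] -/
theorem torsionMap_comp (f : A.X ⟶ A'.X) [IsMonHom f] (g : A'.X ⟶ A''.X) [IsMonHom g] (N : ℕ) :
    torsionMap (f ≫ g) N = torsionMap f N ≫ torsionMap g N :=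
  A''.torsion_hom_ext (by simp only [Category.assoc, torsionMap_ι, torsionMap_ι_assoc])

/-- `f[N]` commutes with the inclusions `A[N] ↪ A[M]` (`N ∣ M`). [cite: Tate1967, §2 (2.1)] -/
@[reassoc]
theorem torsionIncl_comp_torsionMap (f : A.X ⟶ A'.X) [IsMonHom f] (N M : ℕ) (h : N ∣ M) :
    A.torsionIncl N M h ≫ torsionMap f M = torsionMap f N ≫ A'.torsionIncl N M h :=
  A'.torsion_hom_ext (by rw [Category.assoc, torsionMap_ι, torsionIncl_ι_assoc, Category.assoc, torsionIncl_ι, torsionMap_ι])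

/-- `f[M']` commutes with the maps `[N] : A[M'] → A[M]` (`M' = N M`). [cite: Tate1967, §2 (2.1)] -/
@[reassoc]
theorem torsionMulMap_comp_torsionMap (f : A.X ⟶ A'.X) [IsMonHom f] (N M M' : ℕ) (hM : M' = N * M) :
    A.torsionMulMap N M M' hM ≫ torsionMap f M = torsionMap f M' ≫ A'.torsionMulMap N M M' hM :=
  A'.torsion_hom_ext (by
    simp only [Category.assoc, torsionMap_ι, torsionMulMap_ι_assoc, torsionMulMap_ι, torsionMap_ι_assoc,
      mulN_comp_eq_comp_mulN])

/-- The commuting square of underlying schemes `A[N] →(f[N]) A'[N]; A →(f) A'` (it is cartesian only when `f` is, e.g., an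
isomorphism — not claimed). [cite: Tate1967, §2 (2.1)] -/
theorem torsionMap_left_comp (f : A.X ⟶ A'.X) [IsMonHom f] (N : ℕ) :
    (torsionMap f N).left ≫ (A'.torsionι N).left = (A.torsionι N).left ≫ f.left := by
  rw [← Over.comp_left, torsionMap_ι, Over.comp_left]

section Group

variable [IsCommMonObj A.X] [IsCommMonObj A'.X]

/-- `f[N]` is a HOMOMORPHISM of `S`-group schemes (for the kernel group laws ★ `torsionGrpObj`). [cite: Tate1967, §2 (2.1)] -/
theorem isMonHom_torsionMap (f : A.X ⟶ A'.X) [IsMonHom f] (N : ℕ) :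
    letI := A.torsionGrpObj N; letI := A'.torsionGrpObj N; IsMonHom (torsionMap f N) := by
  letI := A.torsionGrpObj N
  haveI := A.isMonHom_torsionι N
  haveI := A'.isMonHom_mulN N
  unfold torsionMap torsionLift
  exact GroupSchemeKernel.isMonHom_kerLift _ _

end Group

/-! ## §2 `f[p^∞] : A[p^∞] → A'[p^∞]` -/

section PDivisible

variable [IsCommMonObj A.X] [IsCommMonObj A'.X] [IsCommMonObj A''.X] {p g g' g'' : ℕ}

/-- **`f[p^∞] : A[p^∞] → A'[p^∞]`, the homomorphism of Barsotti–Tate groups induced by a homomorphism `f : A → A'` of abelian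
schemes** (layers `f[p^n]`; Tate: `A ↦ A(p)` is a functor).  Heights `2g`, `2g'` may differ. [cite: Tate1967, §2 (2.1)] -/
def pDivisibleGroupMap (f : A.X ⟶ A'.X) [IsMonHom f] (hp : p ≠ 0) (hg : A.IsOfRelDim g) (hg' : A'.IsOfRelDim g') :
    BTGroup.Hom (A.pDivisibleGroup hp hg) (A'.pDivisibleGroup hp hg') where
  app n := torsionMap f (p ^ n)
  isMonHom_app n := isMonHom_torsionMap f (p ^ n)
  incl_comp_app n := torsionIncl_comp_torsionMap f (p ^ n) (p ^ (n + 1)) (pow_dvd_pow p n.le_succ)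

/-- The layers of `f[p^∞]` are the `f[p^n]` (unfolding). [cite: Tate1967, §2 (2.1)] -/
@[simp]
theorem pDivisibleGroupMap_app (f : A.X ⟶ A'.X) [IsMonHom f] (hp : p ≠ 0) (hg : A.IsOfRelDim g) (hg' : A'.IsOfRelDim g')
    (n : ℕ) : (pDivisibleGroupMap f hp hg hg').app n = torsionMap f (p ^ n) := rfl

/-- `f[p^∞]` restricts `f`: `app n ≫ ι = ι ≫ f`. [cite: Tate1967, §2 (2.1)] -/
theorem pDivisibleGroupMap_app_comp_ι (f : A.X ⟶ A'.X) [IsMonHom f] (hp : p ≠ 0) (hg : A.IsOfRelDim g)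
    (hg' : A'.IsOfRelDim g') (n : ℕ) :
    (pDivisibleGroupMap f hp hg hg').app n ≫ A'.torsionι (p ^ n) = A.torsionι (p ^ n) ≫ f :=
  torsionMap_ι f (p ^ n)

/-- **Functoriality, identities**: `(𝟙 A)[p^∞] = 𝟙`. [cite: Tate1967, §2 (2.1)] -/
theorem pDivisibleGroupMap_id (hp : p ≠ 0) (hg : A.IsOfRelDim g) :
    pDivisibleGroupMap (𝟙 A.X) hp hg hg = BTGroup.Hom.id (A.pDivisibleGroup hp hg) :=
  BTGroup.Hom.ext fun n => torsionMap_id (p ^ n)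

/-- **Functoriality, composition**: `(f ≫ f')[p^∞] = f[p^∞] ≫ f'[p^∞]`. [cite: Tate1967, §2 (2.1)] -/
theorem pDivisibleGroupMap_comp (f : A.X ⟶ A'.X) [IsMonHom f] (f' : A'.X ⟶ A''.X) [IsMonHom f'] (hp : p ≠ 0)
    (hg : A.IsOfRelDim g) (hg' : A'.IsOfRelDim g') (hg'' : A''.IsOfRelDim g'') :
    pDivisibleGroupMap (f ≫ f') hp hg hg'' = (pDivisibleGroupMap f hp hg hg').comp (pDivisibleGroupMap f' hp hg' hg'') :=
  BTGroup.Hom.ext fun n => torsionMap_comp f f' (p ^ n)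

/-- **Uniqueness**: a homomorphism of Barsotti–Tate groups `A[p^∞] → A'[p^∞]` restricting `f` on every layer IS `f[p^∞]`
(the `ι` are monomorphisms). [cite: Tate1967, §2 (2.1)] -/
theorem eq_pDivisibleGroupMap_of_app_comp_ι (f : A.X ⟶ A'.X) [IsMonHom f] (hp : p ≠ 0) (hg : A.IsOfRelDim g)
    (hg' : A'.IsOfRelDim g') (F : BTGroup.Hom (A.pDivisibleGroup hp hg) (A'.pDivisibleGroup hp hg'))
    (hF : ∀ n, F.app n ≫ A'.torsionι (p ^ n) = A.torsionι (p ^ n) ≫ f) : F = pDivisibleGroupMap f hp hg hg' :=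
  BTGroup.Hom.ext fun n => A'.torsion_hom_ext ((hF n).trans (torsionMap_ι f (p ^ n)).symm)

end PDivisible

end AbelianSchemeOver

end Literature.AlgebraicGeometry.AbelianSchemes

end
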